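import Mathlib.Data.Int.Basic
import Mathlib.Algebra.BigOperators.Fin
import Mathlib.Data.Fintype.Fin
import Mathlib.Tactic
import HarnessLib

/-!
# The Levi-Civita symbol in four dimensions: contraction and `so(4)`-invariance identities

Linear-algebra support file (everything proved; one computable definition, no named facts) for
the `S³` spectral block of A. Waldron, *Long-time existence for Yang–Mills flow*, Invent. math.
217 (2019), Lemma 3.5(a) (first eigenvalue `4` on closed 2-forms of `S³`): the flat proof goes
through the Hodge dual `u_a = ½ ε_{abcd} x_b W_{cd}` of a tangential 2-form `W` on
`S³ ⊂ ℝ⁴`, for which we need, on the index level,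

* `lc4 a b c d = sgn((b−a)(c−a)(d−a)(c−b)(d−b)(d−c)) ∈ {−1, 0, 1}` — the symbol (computable);
* `lc4_swap₁₂ / ₂₃ / ₃₄` — antisymmetry; `lc4_0123 = 1`;
* `lc4_contract` — **one-index contraction**
  `∑ₐ ε_{abcd} ε_{ab'c'd'} = δ_{bb'}(δ_{cc'}δ_{dd'} − δ_{cd'}δ_{dc'}) − δ_{bc'}(δ_{cb'}δ_{dd'} − δ_{cd'}δ_{db'}) + δ_{bd'}(δ_{cb'}δ_{dc'} − δ_{cc'}δ_{db'})`;
* `lc4_derivation` — **infinitesimal `so(4)`-invariance**: for the elementary rotation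
  `M_{ij} e_a = δ_{ai} e_j − δ_{aj} e_i`, `∑_{slots} ε(…, M_{ij} e, …) = 0`.
All identities are decided by computation over `Fin 4`.

References: A. Waldron, Invent. math. 217 (2019), Lemma 3.5 [Waldron2019]; [folklore].
-/

namespace Literature.Analysis.InnerProduct

/-- The four-dimensional Levi-Civita symbol, as the sign of the Vandermonde product. [folklore] -/
def lc4 (a b c d : Fin 4) : ℤ :=
  Int.sign (((b : ℤ) - a) * ((c : ℤ) - a) * ((d : ℤ) - a) * ((c : ℤ) - b) * ((d : ℤ) - b) * ((d : ℤ) - c))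

/-- `ε₀₁₂₃ = 1`. [folklore] -/
theorem lc4_0123 : lc4 0 1 2 3 = 1 := by decide

/-- Antisymmetry in the first two slots. [folklore] -/
theorem lc4_swap₁₂ (a b c d : Fin 4) : lc4 b a c d = -lc4 a b c d := by
  revert a b c d; decide

/-- Antisymmetry in the middle slots. [folklore] -/
theorem lc4_swap₂₃ (a b c d : Fin 4) : lc4 a c b d = -lc4 a b c d := by
  revert a b c d; decide

/-- Antisymmetry in the last two slots. [folklore] -/
theorem lc4_swap₃₄ (a b c d : Fin 4) : lc4 a b d c = -lc4 a b c d := by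
  revert a b c d; decide

/-- The symbol vanishes on a repeated index (first two). [folklore] -/
theorem lc4_self₁₂ (a c d : Fin 4) : lc4 a a c d = 0 := by
  revert a c d; decide

/-- Kronecker delta on `Fin 4`, integer-valued. [folklore] -/
def δ4 (a b : Fin 4) : ℤ := if a = b then 1 else 0

/-- **One-index contraction of two Levi-Civita symbols.** [folklore] -/
theorem lc4_contract (b c d b' c' d' : Fin 4) :
    ∑ a, lc4 a b c d * lc4 a b' c' d' =
      δ4 b b' * (δ4 c c' * δ4 d d' - δ4 c d' * δ4 d c') -
        δ4 b c' * (δ4 c b' * δ4 d d' - δ4 c d' * δ4 d b') +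
        δ4 b d' * (δ4 c b' * δ4 d c' - δ4 c c' * δ4 d b') := by
  revert b c d b' c' d'; decide

/-- **Infinitesimal `so(4)`-invariance of the symbol**: for the elementary rotation
`M_{ij} e_a = δ_{ai} e_j − δ_{aj} e_i`, the sum over the four slots of `ε` with `M_{ij}` inserted
vanishes (the trace of `M_{ij}` is zero). [folklore] -/
theorem lc4_derivation (i j a b c d : Fin 4) :
    (δ4 a i * lc4 j b c d - δ4 a j * lc4 i b c d) + (δ4 b i * lc4 a j c d - δ4 b j * lc4 a i c d) +
      (δ4 c i * lc4 a b j d - δ4 c j * lc4 a b i d) + (δ4 d i * lc4 a b c j - δ4 d j * lc4 a b c i) = 0 := by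
  revert i j a b c d; decide

end Literature.Analysis.InnerProduct
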